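import Literature.AlgebraicGeometry.Motives.VerticalSurfacePlanes
import Literature.AlgebraicGeometry.Motives.FibreVerticalLinesDim
import Literature.AlgebraicGeometry.Motives.IntegralLineFormsFromPluecker
import Literature.AlgebraicGeometry.Motives.ProductTrickBase
import Literature.RingTheory.MvPolynomial.TwoPointLineChainsCr
import HarnessLib

/-!
# `2`-cycles on a cubic hypersurface of dimension `≥ 18` are sums of planes (the product trick)

For a cubic hypersurface `X = V₊(F) ⊆ ℙᵈ⁺¹_k` over an algebraically closed field, `d ≥ 18`, every
integral surface `S ⊆ X` is rationally equivalent on `X` to an integral combination of PLANES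
(`ProjFamily.exists_planes_of_height_two`) — input (a) of Mboro's Cor. 2.9 (i) in this range.
The argument is the product trick of Tian–Zong (proof of Prop. 7.2) one dimension up:

* the generic point `γ ∈ X(K)`, `K = κ(S)`, a constant point `x₀ ⊗ K` and a Tsen–Lang point
  `r ∈ X(K)` (`K` is `C₂` for systems, `19 < d + 2`) span two `K`-lines `γ r, x₀ r ⊆ X_K`;
* over the base `T = closure (γ, [γ ∧ r], [x₀ ∧ r]) ⊆ X × ℙ^𝐍 × ℙ^𝐍` (an integral proper surface
  with `k(T) = K` along which both line maps are morphisms, `Motives/ProductTrickBase`), the closures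
  of the two lines carry the relations `c'ᵢ ∈ Rat₂(X ×ₖ T)` of `Motives/PlaneFamilyRelation`
  (`exists_relation_of_two_points_on_line_surfaceBase`);
* pushed forward to `X`: the `γ`-section gives `[S]`, the constant section `0`, the `r`-sections
  cancel, and every vertical component — over a CURVE of `T` by the chart analysis
  (`Motives/IntegralLineFormsFromPluecker`, `Motives/FibreVerticalLines(Dim)`), closed base points being
  excluded (`exists_forms_of_vertical_of_mem`) — is a family of lines over a curve, hence a sum of
  planes modulo `Rat₂(X)` (`Motives/VerticalSurfacePlanes`, `d ≥ 14`).

Everything is proved; no definitions, no named facts.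

## References

* [TianZong2014] Z. Tian, H. R. Zong, *One-cycles on rationally connected varieties*, Compositio
  Math. 150 (2014), Prop. 7.2 (proof).
* [Mboro2018] R. Mboro, *Remarks on the CH₂ of cubic hypersurfaces*, arXiv:1701.04488, Cor. 2.9.
* [Pfister1995] A. Pfister, *Quadratic Forms with Applications…*, Ch. 5 Cor. 1.5 (Tsen–Lang).
-/

noncomputable section

open CategoryTheory CategoryTheory.Limits AlgebraicGeometry MonoidalCategory MvPolynomial
  TopologicalSpace Order

universe u

namespace Literature.AlgebraicGeometry.Motives

attribute [local instance] MvPolynomial.gradedAlgebra MvPolynomial.algebraMvPolynomial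
  Literature.AlgebraicGeometry.Motives.ProjBaseChange.algebraBase
  UniversalHyperplaneSection.sectionsAlgebra ProjFamily.functionFieldAlgebra

namespace ProjFamily

open ProjBaseChangeRing ProjectiveSpaceCells ProjectiveSpace FanoScheme
  Literature.RingTheory.MvPolynomial Literature.FieldTheory.QuasiAlgClosed

variable {k : Type u} [Field k]

/-! ### Evaluation of a linear form with given coefficient vector -/

/-- `eval w (lin v) = Σ_j v_j w_j`. [folklore] -/
theorem eval_lin_eq_sum {K : Type u} [Field K] {N : ℕ} (v w : Fin (N + 1) → K) :
    eval w (lin v) = ∑ j, v j * w j := by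
  simp only [lin, map_sum, MvPolynomial.smul_eq_C_mul, map_mul, eval_C, eval_X]

/-! ### Vertical components of a line family over the surface base -/

section Vertical

variable [IsAlgClosed k] {d : ℕ} (T : SchemeOver k) [IsIntegral T.left] [IsProper T.hom]
  (X : SchemeOver k) (i : X ⟶ projectiveSpace (d + 1) k) [IsClosedImmersion i.left]
  {F : MvPolynomial (Fin (d + 1 + 1)) k}

/-- **Vertical components over the surface base are sums of planes.** Let `T` be an integral proper
base with generic point of dimension `2` and `f : T → ℙ^𝐍` a `k`-morphism whose generic point is the
Plücker point `[x ∧ y]` of the `k(T)`-line `span(x, y) ⊆ X_{k(T)}`. If `z ∈ X ×ₖ T` has dimension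
`2`, does not lie over the generic point, and lies in the closure of (the lift of) the generic point
of the line, then `pr₁₊ [z]` is rationally equivalent on `X` to an integral combination of planes:
`pr₂ z` cannot be closed (the limit of the line at a closed point is a line, of dimension `1 < 2`),
so it is a curve point and `z` sweeps a family of lines over that curve (`d ≥ 14`).
[cite: TianZong2014, Prop. 7.2 (proof)] [cite: Mboro2018, Cor. 2.9] -/
theorem exists_planes_of_vertical (hd : 14 ≤ d) (hF3 : F.IsHomogeneous 3)
    (hrange : Set.range i.left.base =
      ProjectiveSpectrum.zeroLocus (homogeneousSubmodule (Fin (d + 1 + 1)) k) {F})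
    (hT2 : height (genericPoint T.left) = 2)
    [QuasiCompact (CartesianMonoidalCategory.fst X T).left]
    (f : T ⟶ projectiveSpace ((d + 1) * (d + 1) + 2 * (d + 1)) k)
    (x y : Fin (d + 1 + 1) → T.left.functionField)
    (P : Fin ((d + 1) * (d + 1) + 2 * (d + 1) + 1) → T.left.functionField)
    (hPw : ∀ a b, P (plIdx (d + 1) (a, b)) = wedge x y a b) (hP0 : P ≠ 0)
    (hP : qgen T ≫ f.left = (pointOfVec k P hP0).left)
    {μ : Fin (d + 1 - 1) → MvPolynomial (Fin (d + 1 + 1)) T.left.functionField}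
    (hμli : LinearIndependent T.left.functionField μ) (hμhom : ∀ l, (μ l).IsHomogeneous 1)
    (hμideal : ∀ G : MvPolynomial (Fin (d + 1 + 1)) T.left.functionField,
      (∀ s t : T.left.functionField, eval (s • x + t • y) G = 0) → G ∈ Ideal.span (Set.range μ))
    {lamX : ↥(XK T X)}
    (hlamX : (iK (d + 1) T X i).base lamX = linearSubspacePoint μ hμli hμhom (Nat.sub_le (d + 1) 1))
    {z : ↥(X ⊗ T).left} (hz2 : height z = 2)
    (hzη : (CartesianMonoidalCategory.snd X T).left.base z ≠ genericPoint T.left)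
    (hzS : z ∈ closure {(ιX T X).base lamX}) :
    ∃ (s : Finset ↥X.left) (w : ↥X.left → ℤ), (∀ y' ∈ s, IsLinearSubspacePoint 2 (d + 1) i y') ∧
      IsRationallyEquivalent
        (AlgebraicCycle.map (CartesianMonoidalCategory.fst X T).left height height (primeCycle z))
        (∑ y' ∈ s, w y' • primeCycle y') 2 := by
  classical
  -- an affine neighbourhood of `b = pr₂ z`, and `b` as a point of it
  obtain ⟨_, ⟨U, hU, rfl⟩, hbU, -⟩ := T.left.isBasis_affineOpens.exists_subset_of_mem_open
    (Set.mem_univ ((CartesianMonoidalCategory.snd X T).left.base z)) isOpen_univ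
  obtain ⟨x', hx'⟩ : ∃ x' : U, (x' : T.left) = (CartesianMonoidalCategory.snd X T).left.base z :=
    ⟨⟨_, hbU⟩, rfl⟩
  set j := (i ▷ T).left with hj
  set lam := linearSubspacePoint μ hμli hμhom (Nat.sub_le (d + 1) 1) with hlam
  -- `w = (i × T) z` lies in the closure of `ι_ℙ λ'`, has dimension `2`, lies over `b`
  have hjι : ∀ q, j.base ((ιX T X).base q) = (genericFibreι (d + 1) T).base ((iK (d + 1) T X i).base q) := by
    intro q
    change ((ιX T X ≫ (i ▷ T).left).base q) = ((iK (d + 1) T X i ≫ genericFibreι (d + 1) T).base q)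
    rw [iK_genericFibreι]
  have hwS : j.base z ∈ closure {(genericFibreι (d + 1) T).base lam} := by
    have h := image_closure_subset_closure_image j.base.hom.continuous
      (s := {(ιX T X).base lamX}) ⟨z, hzS, rfl⟩
    rw [Set.image_singleton, hjι, hlamX] at h
    exact h
  have hw2 : height (j.base z) = 2 := by rw [height_base_eq_of_isClosedImmersion' j z, hz2]
  have hwb : (CartesianMonoidalCategory.snd (projectiveSpace (d + 1) k) T).left.base (j.base z) = (x' : T.left) := by
    change (((i ▷ T).left ≫ (CartesianMonoidalCategory.snd (projectiveSpace (d + 1) k) T).left).base z) = _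
    rw [whiskerRight_left_snd, hx']
  -- `dim b < 2`
  have hblt : height (x' : T.left) < 2 := by
    rw [← hT2]
    have hle : (x' : T.left) ≤ genericPoint T.left :=
      Scheme.le_iff_specializes.mpr (genericPoint_specializes _)
    have hlt : (x' : T.left) < genericPoint T.left := lt_of_le_not_ge hle fun hge =>
      (hx' ▸ hzη) ((Scheme.le_iff_specializes.mp hge).antisymm (genericPoint_specializes _)).eq
    exact height_strictMono hlt (lt_of_le_of_lt (height_mono hlt.le) (by rw [hT2]; exact ENat.coe_lt_top 2))
  -- integral line forms at `b`
  obtain ⟨wv, hliO, hvan⟩ := exists_integralLineForms_of_pluecker (N := d + 1) (by omega) T f x y P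
    hPw hP0 hP (x' : T.left)
  have hlamI : (ProjectiveSpectrum.asHomogeneousIdeal
      (𝒜 := homogeneousSubmodule (Fin (d + 1 + 1)) T.left.functionField) lam).toIdeal =
        Ideal.span (Set.range μ) := toIdeal_linearSubspacePoint μ hμli hμhom _
  have hwmem : ∀ l, lin (Literature.LinearAlgebra.toFrac (T.left.presheaf.stalk (x' : T.left))
      T.left.functionField (wv l)) ∈
      ProjectiveSpectrum.asHomogeneousIdeal (𝒜 := homogeneousSubmodule (Fin (d + 1 + 1)) T.left.functionField) lam := by
    intro l
    change _ ∈ (ProjectiveSpectrum.asHomogeneousIdeal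
      (𝒜 := homogeneousSubmodule (Fin (d + 1 + 1)) T.left.functionField) lam).toIdeal
    rw [hlamI]
    refine hμideal _ fun s t => ?_
    rw [eval_lin_eq_sum]
    exact hvan l _ (Submodule.mem_span_pair.mpr ⟨s, t, rfl⟩)
  -- case `b` closed: impossible
  rcases (show height (x' : T.left) = 0 ∨ height (x' : T.left) = 1 by
      have h2 : height (x' : T.left) ≤ 1 := Order.le_of_lt_add_one (by exact_mod_cast hblt)
      rcases eq_or_lt_of_le h2 with h | h
      · exact Or.inr h
      · exact Or.inl (Order.lt_one_iff.mp h)) with hb0 | hb1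
  · exfalso
    have hbcl : IsClosed ({(x' : T.left)} : Set T.left) := isClosed_singleton_of_height_eq_zero' hb0
    obtain ⟨L, hLli, hLhom, hmem, hheq⟩ := exists_forms_of_vertical_of_mem T (genericFibreι (d + 1) T)
      (genericFibreι_fst (d + 1) T) (genericFibreι_snd (d + 1) T) lam hwS hbcl hwb wv hwmem hliO
    -- `pr₁ w` lies on the line `V₊(L)`, of dimension `≤ 1`, but has dimension `2`
    have hle1 : height ((CartesianMonoidalCategory.fst (projectiveSpace (d + 1) k) T).left.base (j.base z)) ≤ 1 := by
      have hd1 : d + 1 - 1 ≤ d + 1 := Nat.sub_le _ _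
      by_cases hne : (CartesianMonoidalCategory.fst (projectiveSpace (d + 1) k) T).left.base (j.base z) =
          linearSubspacePoint L hLli hLhom hd1
      · rw [hne, height_linearSubspacePoint, show d + 1 - (d + 1 - 1) = 1 by omega]; rfl
      · have hlt := height_lt_of_mem_zeroLocus L hLli hLhom hd1 hmem hne
        rw [show d + 1 - (d + 1 - 1) = 1 by omega] at hlt
        exact le_of_lt hlt
    rw [hheq, hw2] at hle1
    exact absurd hle1 (by norm_num)
  · -- `b` is a curve point: the family of lines over the curve
    letI algκ : Algebra Γ(T.left, U) (IsLocalRing.ResidueField (T.left.presheaf.stalk (x' : T.left))) :=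
      ((IsLocalRing.residue (T.left.presheaf.stalk (x' : T.left))).comp
        (algebraMap Γ(T.left, U) (T.left.presheaf.stalk (x' : T.left)))).toAlgebra
    haveI : IsScalarTower Γ(T.left, U) (T.left.presheaf.stalk (x' : T.left))
        (IsLocalRing.ResidueField (T.left.presheaf.stalk (x' : T.left))) :=
      IsScalarTower.of_algebraMap_eq fun _ => rfl
    have hfin : height (x' : T.left) ≠ ⊤ := by rw [hb1]; exact ENat.coe_ne_top 1
    have hheight : height (j.base z) = height (x' : T.left) + 1 := by rw [hw2, hb1]; rfl
    obtain ⟨hLli, hσ⟩ := exists_fibre_linePoint_of_vertical_of_mem (d + 1) T hU x' (by omega)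
      (genericFibreι (d + 1) T) (genericFibreι_fst (d + 1) T) (genericFibreι_snd (d + 1) T) lam hwS
      hwb hfin hheight wv hwmem hliO
    exact exists_planes_of_vertical_over_curve hd T X i hF3 hrange hU x' hb1 hLli
      (fun _ => isHomogeneous_lin _) hσ.symm

end Vertical

/-! ### The relation for one line over the surface base, pushed forward to `X` -/

section Engine

variable [IsAlgClosed k] {d : ℕ} (T : SchemeOver k) [IsIntegral T.left] [IsProper T.hom]
  (X : SchemeOver k) (i : X ⟶ projectiveSpace (d + 1) k) [IsClosedImmersion i.left]
  {F : MvPolynomial (Fin (d + 1 + 1)) k}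

/-- **The relation for one line over the surface base.** For independent `v₀, v₁ ∈ k(T)ᵈ⁺²` with
`F` vanishing on their span (a `k(T)`-line of `X_{k(T)}`) whose Plücker point is the generic point
of a `k`-morphism `f : T → ℙ^𝐍`: there are `c' ∈ Rat₂(X ×ₖ T)`, the lifts `u₀, u₁ ∈ X_{k(T)}` of
`[v₀], [v₁]`, and a cycle `Pl` on `X` supported on PLANE points with
`pr₁₊ c' - (pr₁₊[ι u₀] - pr₁₊[ι u₁]) - Pl ∈ Rat₂(X)` (the vertical components are sums of planes,
`exists_planes_of_vertical`). [cite: TianZong2014, Prop. 7.2 (proof)] -/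
theorem exists_relation_of_line_over_T (hd : 14 ≤ d) (hF3 : F.IsHomogeneous 3)
    (hrange : Set.range i.left.base =
      ProjectiveSpectrum.zeroLocus (homogeneousSubmodule (Fin (d + 1 + 1)) k) {F})
    (hT2 : height (genericPoint T.left) = 2)
    [QuasiCompact (CartesianMonoidalCategory.fst X T).left]
    (f : T ⟶ projectiveSpace ((d + 1) * (d + 1) + 2 * (d + 1)) k)
    (v : Fin 2 → Fin (d + 1 + 1) → T.left.functionField)
    (hv : LinearIndependent T.left.functionField v)
    (hFv : ∀ s t : T.left.functionField,
      eval (s • v 0 + t • v 1) (MvPolynomial.map (algebraMap k T.left.functionField) F) = 0)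
    (P : Fin ((d + 1) * (d + 1) + 2 * (d + 1) + 1) → T.left.functionField)
    (hPw : ∀ a b, P (plIdx (d + 1) (a, b)) = wedge (v 0) (v 1) a b) (hP0 : P ≠ 0)
    (hP : qgen T ≫ f.left = (pointOfVec k P hP0).left) :
    ∃ c' ∈ ratTrivial (X ⊗ T).left 2, ∃ uX : Fin 2 → ↥(XK T X),
      (∀ a, (iK (d + 1) T X i).base (uX a) =
        (pointOfVec T.left.functionField (v a) (hv.ne_zero a)).pt) ∧
      ∃ Pl : AlgebraicCycle X.left ℤ, (∀ y, Pl y ≠ 0 → IsLinearSubspacePoint 2 (d + 1) i y) ∧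
        AlgebraicCycle.map (CartesianMonoidalCategory.fst X T).left height height c' -
          (AlgebraicCycle.map (CartesianMonoidalCategory.fst X T).left height height
              (primeCycle ((ιX T X).base (uX 0))) -
            AlgebraicCycle.map (CartesianMonoidalCategory.fst X T).left height height
              (primeCycle ((ιX T X).base (uX 1)))) - Pl ∈ ratTrivial X.left 2 := by
  classical
  haveI : IsProper (projectiveSpace (d + 1) k).hom := isProper_projectiveSpace (d + 1) k
  haveI : IsProper X.hom := by rw [← Over.w i]; infer_instance
  haveI : QuasiCompact (X ⊗ T).hom :=
    inferInstanceAs (QuasiCompact (pullback.fst X.hom T.hom ≫ X.hom))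
  haveI : CompactSpace ↥(X ⊗ T).left := compactSpace_of_quasiCompact_hom (X ⊗ T)
  haveI := infinite_functionField (k := k) T
  have hN : 1 ≤ d + 1 := by omega
  obtain ⟨μ, hμli, hμhom, hμv, hμideal⟩ := exists_lineForms v hv hN
  have hFspan : MvPolynomial.map (algebraMap k T.left.functionField) F ∈ Ideal.span (Set.range μ) :=
    hμideal _ hFv
  have hrange' : Set.range i.left.base =
      ProjectiveSpectrum.zeroLocus (homogeneousSubmodule (Fin (d + 1 + 1)) k)
        (Set.range fun _ : Fin 1 => F) := by
    rw [hrange]; congr 1; ext G; simp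
  have hline := zeroLocus_subset_range_iK (d + 1) T X i (fun _ : Fin 1 => F) hrange' μ
    (fun _ => hFspan)
  have hu : ∀ a, (pointOfVec T.left.functionField (v a) (hv.ne_zero a)).pt ∈
      ProjectiveSpectrum.zeroLocus (homogeneousSubmodule (Fin (d + 1 + 1)) T.left.functionField)
        (Set.range μ) := by
    rintro a _ ⟨l, rfl⟩
    exact mem_asHomogeneousIdeal_pt_pointOfVec (hv.ne_zero a) zero_lt_one (hμhom l) (hμv l a)
  obtain ⟨c', hc', uX, vX, lamX, huX, hvX, hlamX, vert, hcv, hvert⟩ :=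
    exists_relation_of_two_points_on_line_surfaceBase T X i hN hT2 μ hμli hμhom hline (hu 0) (hu 1)
      (height_pt _) (height_pt _) (by rw [residueDegree_pt, residueDegree_pt])
  -- push-forward
  let M : AlgebraicCycle (X ⊗ T).left ℤ →+ AlgebraicCycle X.left ℤ :=
    AddMonoidHom.mk' (AlgebraicCycle.map (CartesianMonoidalCategory.fst X T).left height height)
      (algebraicCycleMap_add _ height height)
  -- every vertical component is a sum of planes modulo `Rat₂(X)`
  have hV : ∀ z, vert z ≠ 0 → ∃ Plz : AlgebraicCycle X.left ℤ,
      (∀ y, Plz y ≠ 0 → IsLinearSubspacePoint 2 (d + 1) i y) ∧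
        M (primeCycle z) - Plz ∈ ratTrivial X.left 2 := by
    intro z hz
    obtain ⟨hz2, hzη, hzS⟩ := hvert z hz
    obtain ⟨s, w, hs, hrat⟩ := exists_planes_of_vertical T X i hd hF3 hrange hT2 f (v 0) (v 1) P hPw
      hP0 hP hμli hμhom hμideal hlamX hz2 hzη hzS
    refine ⟨∑ y ∈ s, w y • primeCycle y, fun y hy => hs y ?_, hrat⟩
    by_contra hys
    apply hy
    simp only [Function.locallyFinsuppWithin.coe_sum, Finset.sum_apply,
      Function.locallyFinsuppWithin.coe_zsmul, Pi.smul_apply, smul_eq_mul]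
    refine Finset.sum_eq_zero fun y' hy' => ?_
    have hne : y ≠ y' := fun h => hys (h ▸ hy')
    rw [primeCycle_apply_of_ne hne, mul_zero]
  choose! Plz hPlz using hV
  let S : Finset ↥(X ⊗ T).left := (finite_support_of_compactSpace vert).toFinset
  have hSmem : ∀ z, z ∈ S ↔ vert z ≠ 0 := fun z => by
    simp only [S, Set.Finite.mem_toFinset, Function.mem_support]
  let Pl : AlgebraicCycle X.left ℤ := ∑ z ∈ S, vert z • Plz z
  have hPl : ∀ y, Pl y ≠ 0 → IsLinearSubspacePoint 2 (d + 1) i y := by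
    intro y hy
    have : ∃ z ∈ S, (Plz z) y ≠ 0 := by
      by_contra hnone
      push Not at hnone
      apply hy
      simp only [Pl, Function.locallyFinsuppWithin.coe_sum, Finset.sum_apply,
        Function.locallyFinsuppWithin.coe_zsmul, Pi.smul_apply, smul_eq_mul]
      exact Finset.sum_eq_zero fun z hz => by rw [hnone z hz, mul_zero]
    obtain ⟨z, hzS, hzy⟩ := this
    exact (hPlz z ((hSmem z).1 hzS)).1 y hzy
  have hvertsum : vert = ∑ z ∈ S, vert z • primeCycle z :=
    eq_sum_smul_primeCycle_of_support_subset vert (s := S) (by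
      intro z hz; exact (Finset.mem_coe.2 ((hSmem z).2 (Function.mem_support.1 hz))))
  have hMvert : M vert - Pl ∈ ratTrivial X.left 2 := by
    have hdiff : M vert - Pl = ∑ z ∈ S, vert z • (M (primeCycle z) - Plz z) := by
      conv_lhs => rw [hvertsum]
      simp only [Pl, map_sum, map_zsmul, ← Finset.sum_sub_distrib, smul_sub]
    rw [hdiff]
    exact AddSubgroup.sum_mem _ fun z hz => AddSubgroup.zsmul_mem _ (hPlz z ((hSmem z).1 hz)).2 _
  refine ⟨c', hc', ![uX, vX], fun a => ?_, Pl, hPl, ?_⟩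
  · fin_cases a
    · exact huX
    · exact hvX
  · have hMc : M c' = M (primeCycle ((ιX T X).base uX)) - M (primeCycle ((ιX T X).base vX)) + M vert := by
      rw [hcv, map_add, map_sub]
    change M c' - (M (primeCycle ((ιX T X).base uX)) - M (primeCycle ((ιX T X).base vX))) - Pl ∈ _
    rw [hMc]
    convert hMvert using 1
    abel

end Engine

/-! ### Two lines through the generic point and a constant point: the push-forward relation -/

section TwoLines

variable [IsAlgClosed k] {d : ℕ} (X : SchemeOver k) (i : X ⟶ projectiveSpace (d + 1) k)
  [IsClosedImmersion i.left] {F : MvPolynomial (Fin (d + 1 + 1)) k}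

omit [IsAlgClosed k] in
/-- Evaluation after a change of the coefficient field along `φ : K₀ → K` compatible with `k`:
`(F ⊗ 1_K)(φ ∘ u) = φ ((F ⊗ 1_{K₀})(u))`. [folklore] -/
theorem eval_comp_map_eq {K₀ K : Type u} [Field K₀] [Field K] [Algebra k K₀] [Algebra k K]
    (φ : K₀ →+* K) (hφ : ∀ c : k, φ (algebraMap k K₀ c) = algebraMap k K c)
    (u : Fin (d + 1 + 1) → K₀) (G : MvPolynomial (Fin (d + 1 + 1)) k) :
    eval (fun j => φ (u j)) (MvPolynomial.map (algebraMap k K) G) =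
      φ (eval u (MvPolynomial.map (algebraMap k K₀) G)) := by
  rw [MvPolynomial.eval_map, MvPolynomial.eval_map, MvPolynomial.eval₂_comp_left]
  congr 1
  ext c
  exact (hφ c).symm

/-- **The product trick for a surface of a cubic hypersurface (core).** Let `X = V₊(F) ⊆ ℙᵈ⁺¹_k` be a
cubic hypersurface (`d ≥ 14`), `a₀ ∈ X(K₀)` a preimmersed `K₀`-point with underlying point `z` of
dimension `trdeg_k K₀ = 2` (the generic point of an integral surface `S ⊆ X`, `K₀ = κ(S)`), `x₀ ∈ X`
a closed point, and `v₁ = (p, r)`, `v₂ = (q, r')` two pairs of independent vectors of `K₀ᵈ⁺²` with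
`F` vanishing on their spans, `[p] = a₀`, `[q] = x₀ ⊗ K₀`, and either `r = q` (one line `p q`) or
`r = r'` (two lines through a common point). Then `[S]` is rationally equivalent on `X` to an integral
combination of planes. (Base `T = closure (a₀, [p ∧ r], [q ∧ r'])`; the two line-family relations
over `T` pushed forward to `X`.) [cite: TianZong2014, Prop. 7.2 (proof)] [cite: Mboro2018, Cor. 2.9] -/
theorem exists_planes_of_two_lines (hd : 14 ≤ d) (hF3 : F.IsHomogeneous 3)
    (hrange : Set.range i.left.base =
      ProjectiveSpectrum.zeroLocus (homogeneousSubmodule (Fin (d + 1 + 1)) k) {F})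
    {K₀ : Type u} [Field K₀] [Algebra k K₀] (htr : Algebra.trdeg k K₀ = 2)
    (a₀ : AlgPoints X K₀) [IsPreimmersion a₀.left] {z : ↥X.left} (ha₀z : a₀.pt = z)
    {x₀ : ↥X.left} (hx₀ : IsClosed ({x₀} : Set ↥X.left)) (hx₀0 : height x₀ = 0)
    (v₁ v₂ : Fin 2 → Fin (d + 1 + 1) → K₀)
    (hv₁ : LinearIndependent K₀ v₁) (hv₂ : LinearIndependent K₀ v₂)
    (hF₁ : ∀ s t : K₀, eval (s • v₁ 0 + t • v₁ 1) (MvPolynomial.map (algebraMap k K₀) F) = 0)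
    (hF₂ : ∀ s t : K₀, eval (s • v₂ 0 + t • v₂ 1) (MvPolynomial.map (algebraMap k K₀) F) = 0)
    (hp0 : v₁ 0 ≠ 0) (hp : AlgPoints.map i a₀ = pointOfVec k (v₁ 0) hp0)
    (hq0 : v₂ 0 ≠ 0)
    (hq : haveI : IsProper (projectiveSpace (d + 1) k).hom := isProper_projectiveSpace (d + 1) k
      haveI : LocallyOfFiniteType X.hom := by rw [← Over.w i]; infer_instance
      AlgPoints.map i (AlgPoints.mk (Spec.map (CommRingCat.ofHom (algebraMap k K₀)) ≫
        pointOfClosedPoint X.hom x₀ hx₀) (by rw [Category.assoc, pointOfClosedPoint_comp, Category.comp_id])) =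
        pointOfVec k (v₂ 0) hq0)
    (hsecond : v₁ 1 = v₂ 0 ∨ v₁ 1 = v₂ 1) :
    ∃ (s : Finset ↥X.left) (w : ↥X.left → ℤ), (∀ y ∈ s, IsLinearSubspacePoint 2 (d + 1) i y) ∧
      IsRationallyEquivalent (primeCycle z) (∑ y ∈ s, w y • primeCycle y) 2 := by
  classical
  -- instances on `X`
  haveI : IsProper (projectiveSpace (d + 1) k).hom := isProper_projectiveSpace (d + 1) k
  haveI : IsProper X.hom := by rw [← Over.w i]; infer_instance
  haveI : CompactSpace ↥X.left := compactSpace_of_quasiCompact_hom X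
  -- the Plücker space and the Plücker vectors of the two lines
  let NN : ℕ := (d + 1) * (d + 1) + 2 * (d + 1)
  let PN : SchemeOver k := projectiveSpace NN k
  haveI : IsProper PN.hom := isProper_projectiveSpace NN k
  let w₁ : Fin (NN + 1) → K₀ := fun c => wedge (v₁ 0) (v₁ 1) ((plIdx (d + 1)).symm c).1 ((plIdx (d + 1)).symm c).2
  let w₂ : Fin (NN + 1) → K₀ := fun c => wedge (v₂ 0) (v₂ 1) ((plIdx (d + 1)).symm c).1 ((plIdx (d + 1)).symm c).2
  have hmat : ∀ (v : Fin 2 → Fin (d + 1 + 1) → K₀), (![v 0, v 1] : Fin 2 → _) = v := by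
    intro v; ext a j; fin_cases a <;> rfl
  have hwne : ∀ (v : Fin 2 → Fin (d + 1 + 1) → K₀), LinearIndependent K₀ v →
      (fun c => wedge (v 0) (v 1) ((plIdx (d + 1)).symm c).1 ((plIdx (d + 1)).symm c).2) ≠ 0 := by
    intro v hv h0
    apply (wedge_ne_zero_iff (v 0) (v 1)).2 (by rw [hmat]; exact hv)
    funext a b
    have := congr_fun h0 (plIdx (d + 1) (a, b))
    simpa using this
  have hw₁ : w₁ ≠ 0 := hwne v₁ hv₁
  have hw₂ : w₂ ≠ 0 := hwne v₂ hv₂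
  -- the ambient `Y = X × ℙ^𝐍 × ℙ^𝐍` and the `K₀`-point `Q = (a₀, [w₁], [w₂])`
  let Y : SchemeOver k := (X ⊗ PN) ⊗ PN
  let Q : AlgPoints Y K₀ :=
    AlgPoints.prodEquiv.symm (AlgPoints.prodEquiv.symm (a₀, pointOfVec k w₁ hw₁), pointOfVec k w₂ hw₂)
  let prXX : Y ⟶ X := CartesianMonoidalCategory.fst _ _ ≫ CartesianMonoidalCategory.fst _ _
  let pr₁ : Y ⟶ PN := CartesianMonoidalCategory.fst _ _ ≫ CartesianMonoidalCategory.snd _ _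
  let pr₂ : Y ⟶ PN := CartesianMonoidalCategory.snd _ _
  have hQX : Q ≫ prXX = a₀ := by
    change CartesianMonoidalCategory.lift (CartesianMonoidalCategory.lift a₀ (pointOfVec k w₁ hw₁))
      (pointOfVec k w₂ hw₂) ≫ (CartesianMonoidalCategory.fst _ _ ≫ CartesianMonoidalCategory.fst _ _) = a₀
    rw [← Category.assoc, CartesianMonoidalCategory.lift_fst, CartesianMonoidalCategory.lift_fst]
  have hQ₁ : Q ≫ pr₁ = pointOfVec k w₁ hw₁ := by
    change CartesianMonoidalCategory.lift (CartesianMonoidalCategory.lift a₀ (pointOfVec k w₁ hw₁))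
      (pointOfVec k w₂ hw₂) ≫ (CartesianMonoidalCategory.fst _ _ ≫ CartesianMonoidalCategory.snd _ _) = _
    rw [← Category.assoc, CartesianMonoidalCategory.lift_fst, CartesianMonoidalCategory.lift_snd]
  have hQ₂ : Q ≫ pr₂ = pointOfVec k w₂ hw₂ := by
    change CartesianMonoidalCategory.lift _ (pointOfVec k w₂ hw₂) ≫ CartesianMonoidalCategory.snd _ _ = _
    rw [CartesianMonoidalCategory.lift_snd]
  -- `𝒪_{Y,Q} → K₀` is onto (through `a₀`, a preimmersion)
  have surj_of_pre : ∀ {Z : Scheme.{u}} (g : Spec (CommRingCat.of K₀) ⟶ Z) [IsPreimmersion g],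
      Function.Surjective (Scheme.stalkClosedPointTo g) := by
    intro Z g _
    change Function.Surjective (g.stalkMap _ ≫ (stalkClosedPointIso (CommRingCat.of K₀)).hom)
    intro y
    obtain ⟨x, hx⟩ := g.stalkMap_surjective _ ((stalkClosedPointIso (CommRingCat.of K₀)).inv y)
    refine ⟨x, ?_⟩
    change (stalkClosedPointIso (CommRingCat.of K₀)).hom (g.stalkMap _ x) = y
    rw [hx, ← CategoryTheory.comp_apply, Iso.inv_hom_id]; rfl
  have hQX' : Q.left ≫ prXX.left = a₀.left := congrArg CommaMorphism.left hQX
  haveI hpreQ : IsPreimmersion (Q.left ≫ prXX.left) := hQX'.symm ▸ (inferInstance : IsPreimmersion a₀.left)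
  have hQ : Function.Surjective (Scheme.stalkClosedPointTo Q.left) := by
    have h : Scheme.stalkClosedPointTo (Q.left ≫ prXX.left) =
        prXX.left.stalkMap _ ≫ Scheme.stalkClosedPointTo Q.left := Scheme.stalkClosedPointTo_comp _ _
    have hs : Function.Surjective (Scheme.stalkClosedPointTo (Q.left ≫ prXX.left)) :=
      @surj_of_pre _ (Q.left ≫ prXX.left) hpreQ
    rw [h] at hs
    exact Function.Surjective.of_comp hs
  -- the base `T`
  obtain ⟨τ, e, hτ1, hτk, hτη, hgen, hek⟩ := exists_ringEquiv_functionField_of_surjective Y Q hQ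
  let T : SchemeOver k := Over.mk ((ClosedSubvariety.ofPoint Y.left Q.pt).ι ≫ Y.hom)
  haveI : IsIntegral T.left := inferInstanceAs (IsIntegral (ClosedSubvariety.ofPoint Y.left Q.pt).carrier)
  haveI : IsProper T.hom := isProper_ofPoint Y Q
  have hT2 : height (genericPoint T.left) = 2 := by
    have h := height_genericPoint_ofPoint_eq_toENat_trdeg Y Q hQ
    rw [htr] at h
    exact h.trans (by simp)
  let Tι : T ⟶ Y := Over.homMk (ClosedSubvariety.ofPoint Y.left Q.pt).ι rfl
  let f₁ : T ⟶ PN := Tι ≫ pr₁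
  let f₂ : T ⟶ PN := Tι ≫ pr₂
  obtain ⟨h0₁, hP₁⟩ := qgen_comp_eq_pointOfVec Y Q hτ1 hgen hek pr₁ hw₁ hQ₁
  obtain ⟨h0₂, hP₂⟩ := qgen_comp_eq_pointOfVec Y Q hτ1 hgen hek pr₂ hw₂ hQ₂
  -- the coefficient field `K = k(T) ≅ K₀`
  let φ : K₀ →+* T.left.functionField := e.symm.toRingHom
  have hφ : ∀ c : k, φ (algebraMap k K₀ c) = algebraMap k T.left.functionField c := fun c => by
    change e.symm (algebraMap k K₀ c) = _
    rw [← hek c, RingEquiv.symm_apply_apply]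
  let φa : K₀ →ₐ[k] T.left.functionField := { φ with commutes' := hφ }
  let V₁ : Fin 2 → Fin (d + 1 + 1) → T.left.functionField := fun a => ⇑φa ∘ v₁ a
  let V₂ : Fin 2 → Fin (d + 1 + 1) → T.left.functionField := fun a => ⇑φa ∘ v₂ a
  letI algφ : Algebra K₀ T.left.functionField := φ.toAlgebra
  have hVli : ∀ (v : Fin 2 → Fin (d + 1 + 1) → K₀), LinearIndependent K₀ v →
      LinearIndependent T.left.functionField (fun a => ⇑φa ∘ v a : Fin 2 → Fin (d + 1 + 1) → T.left.functionField) :=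
    fun v hv => (linearIndependent_algebraMap_comp_iff (R := K₀) (S := T.left.functionField) (v := v)).2 hv
  have hV₁ : LinearIndependent T.left.functionField V₁ := hVli v₁ hv₁
  have hV₂ : LinearIndependent T.left.functionField V₂ := hVli v₂ hv₂
  have hFV : ∀ (v : Fin 2 → Fin (d + 1 + 1) → K₀),
      (∀ s t : K₀, eval (s • v 0 + t • v 1) (MvPolynomial.map (algebraMap k K₀) F) = 0) →
      ∀ s t : T.left.functionField, eval (s • (⇑φa ∘ v 0) + t • (⇑φa ∘ v 1))
        (MvPolynomial.map (algebraMap k T.left.functionField) F) = 0 := by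
    intro v hFv s t
    obtain ⟨s', rfl⟩ := e.symm.surjective s
    obtain ⟨t', rfl⟩ := e.symm.surjective t
    have hfun : (e.symm s' • (⇑φa ∘ v 0) + e.symm t' • (⇑φa ∘ v 1) :
        Fin (d + 1 + 1) → T.left.functionField) = fun j => φ ((s' • v 0 + t' • v 1) j) := by
      funext j
      simp only [Pi.add_apply, Pi.smul_apply, smul_eq_mul, map_add, map_mul, Function.comp_apply]
      rfl
    rw [hfun, eval_comp_map_eq φ hφ, hFv s' t', map_zero]
  -- Plücker data of the two line maps
  have hPw : ∀ (v : Fin 2 → Fin (d + 1 + 1) → K₀) (a b : Fin (d + 1 + 1)),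
      (fun j => e.symm ((fun c => wedge (v 0) (v 1) ((plIdx (d + 1)).symm c).1 ((plIdx (d + 1)).symm c).2) j))
        (plIdx (d + 1) (a, b)) = wedge (⇑φa ∘ v 0) (⇑φa ∘ v 1) a b := by
    intro v a b
    simp only [Equiv.symm_apply_apply]
    exact (congr_fun (congr_fun (wedge_map φ (v 0) (v 1)) a) b).symm
  -- ENGINE, twice
  haveI : QuasiCompact (CartesianMonoidalCategory.fst X T).left :=
    inferInstanceAs (QuasiCompact (pullback.fst X.hom T.hom))
  obtain ⟨c₁, hc₁, uX₁, huX₁, Pl₁, hPl₁, hX₁⟩ := exists_relation_of_line_over_T T X i hd hF3 hrange hT2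
    f₁ V₁ hV₁ (hFV v₁ hF₁) _ (hPw v₁) h0₁ hP₁
  obtain ⟨c₂, hc₂, uX₂, huX₂, Pl₂, hPl₂, hX₂⟩ := exists_relation_of_line_over_T T X i hd hF3 hrange hT2
    f₂ V₂ hV₂ (hFV v₂ hF₂) _ (hPw v₂) h0₂ hP₂
  -- instances and framework on `X × T`
  haveI : IsProper (CartesianMonoidalCategory.fst X T).left :=
    inferInstanceAs (IsProper (pullback.fst X.hom T.hom))
  haveI : LocallyOfFiniteType (X ⊗ T).hom :=
    inferInstanceAs (LocallyOfFiniteType (pullback.fst X.hom T.hom ≫ X.hom))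
  have hPB := isPullback_ιX T X
  have hi := range_qgen T
  have hinjK : Function.Injective (iK (d + 1) T X i).base := (iK (d + 1) T X i).isClosedEmbedding.injective
  -- the generic point `qgen T = Spec e⁻¹ ≫ τ`
  have hcomp : CommRingCat.ofHom e.toRingHom ≫ CommRingCat.ofHom e.symm.toRingHom = 𝟙 _ := by
    ext a; exact e.symm_apply_apply a
  have h1 : Spec.map (CommRingCat.ofHom e.symm.toRingHom) ≫ Spec.map (CommRingCat.ofHom e.toRingHom) = 𝟙 _ := by
    rw [← Spec.map_comp, hcomp, Spec.map_id]
  have hqgen : Spec.map (CommRingCat.ofHom φ) ≫ τ = qgen T := by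
    rw [← hgen]
    exact (reassoc_of% h1) _
  have hcomp' : CommRingCat.ofHom φ ≫ CommRingCat.ofHom e.toRingHom = 𝟙 _ := by
    ext a; exact e.apply_symm_apply a
  have h2 : Spec.map (CommRingCat.ofHom e.toRingHom) ≫ Spec.map (CommRingCat.ofHom φ) = 𝟙 _ := by
    rw [← Spec.map_comp, hcomp', Spec.map_id]
  haveI : IsIso (Spec.map (CommRingCat.ofHom φ)) := ⟨⟨Spec.map (CommRingCat.ofHom e.toRingHom), h1, h2⟩⟩
  haveI : IsOpenImmersion (Spec.map (CommRingCat.ofHom φ)) := inferInstance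
  haveI hpreφ : IsPreimmersion (Spec.map (CommRingCat.ofHom φ)) := inferInstance
  -- `k → k(T)` factors through `φ`
  have halgT : algebraMap k T.left.functionField = φ.comp (algebraMap k K₀) :=
    RingHom.ext fun c => (hφ c).symm
  -- LINK: a `K`-point `a'` of `X` with `a' ≫ i = Spec φ ≫ [u]` lies under `[φ ∘ u] ∈ ℙ_K(K)`
  have link : ∀ (a' : Spec T.left.functionField ⟶ X.left) (ha' : a' ≫ X.hom = qgen T ≫ T.hom)
      (u : Fin (d + 1 + 1) → K₀) (hu0 : u ≠ 0),
      a' ≫ i.left = Spec.map (CommRingCat.ofHom φa.toRingHom) ≫ (pointOfVec k u hu0).left →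
      (pointOfVec T.left.functionField (⇑φa ∘ u) (ProjectiveSpace.comp_ne_zero φa hu0)).pt =
        uPt (d + 1) T X i a' ha' := by
    intro a' ha' u hu0 hai
    -- as morphisms `Spec K → ℙ_K`
    suffices hmor : (pointOfVec T.left.functionField (⇑φa ∘ u) (ProjectiveSpace.comp_ne_zero φa hu0)).left =
        sPt (d + 1) T X i a' ha' by
      change (pointOfVec T.left.functionField (⇑φa ∘ u) (ProjectiveSpace.comp_ne_zero φa hu0)).left.base
        (IsLocalRing.closedPoint _) = (sPt (d + 1) T X i a' ha').base (IsLocalRing.closedPoint _)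
      rw [hmor]
      rfl
    have hsPt : sPt (d + 1) T X i a' ha' ≫ Proj.map (mapGraded k T.left.functionField (Fin (d + 1 + 1)))
        (irrelevant_le_map k T.left.functionField (Fin (d + 1 + 1))) = a' ≫ i.left := by
      have e1 : iK (d + 1) T X i ≫ genericFibreι (d + 1) T ≫
          (CartesianMonoidalCategory.fst (projectiveSpace (d + 1) k) T).left =
            ιX T X ≫ (CartesianMonoidalCategory.fst X T).left ≫ i.left := by
        rw [← Category.assoc, iK_genericFibreι, Category.assoc, whiskerRight_left_fst]
      change (tPt T X a' ha' ≫ iK (d + 1) T X i) ≫ _ = _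
      refine (congrArg ((tPt T X a' ha' ≫ iK (d + 1) T X i) ≫ ·) (genericFibreι_fst (d + 1) T).symm).trans ?_
      refine (Category.assoc _ _ _).trans ?_
      refine (congrArg (tPt T X a' ha' ≫ ·) e1).trans ?_
      refine (Category.assoc _ _ _).symm.trans ?_
      refine (congrArg (· ≫ ((CartesianMonoidalCategory.fst X T).left ≫ i.left)) (tPt_ιX T X a' ha')).trans ?_
      refine (Category.assoc _ _ _).symm.trans ?_
      exact congrArg (· ≫ i.left) (liftPt_fst T X a' ha')
    refine (isPullback_projMap' k T.left.functionField (n := d + 1)).hom_ext ?_ ?_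
    · exact ((pointOfVec_left_comp_projMap (k := k) (⇑φa ∘ u) (ProjectiveSpace.comp_ne_zero φa hu0)).trans
        ((pointOfVec_left_comp_algHom φa u hu0).trans (hai.symm.trans hsPt.symm)))
    · have hs1 : (pointOfVec T.left.functionField (⇑φa ∘ u) (ProjectiveSpace.comp_ne_zero φa hu0)).left ≫
          projToSpec (Fin (d + 1 + 1)) T.left.functionField = 𝟙 _ := by
        have hw := Over.w (pointOfVec T.left.functionField (⇑φa ∘ u) (ProjectiveSpace.comp_ne_zero φa hu0))
        change (pointOfVec T.left.functionField (⇑φa ∘ u) (ProjectiveSpace.comp_ne_zero φa hu0)).left ≫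
          projToSpec (Fin (d + 1 + 1)) T.left.functionField =
            Spec.map (CommRingCat.ofHom (RingHom.id T.left.functionField)) at hw
        rw [hw]
        exact Spec.map_id _
      exact hs1.trans (sPt_projToSpec (d + 1) T X i a' ha').symm
  -- the `γ`-point
  let aT : Spec T.left.functionField ⟶ X.left := qgen T ≫ (ClosedSubvariety.ofPoint Y.left Q.pt).ι ≫ prXX.left
  have haT_ha : aT ≫ X.hom = qgen T ≫ T.hom := by
    change (qgen T ≫ (ClosedSubvariety.ofPoint Y.left Q.pt).ι ≫ prXX.left) ≫ X.hom = qgen T ≫ ((ClosedSubvariety.ofPoint Y.left Q.pt).ι ≫ Y.hom)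
    simp only [Category.assoc, Over.w prXX]
  have hτι : τ ≫ (ClosedSubvariety.ofPoint Y.left Q.pt).ι ≫ prXX.left = a₀.left := by
    rw [← Category.assoc, hτ1]; exact hQX'
  have haT : aT = Spec.map (CommRingCat.ofHom φ) ≫ a₀.left := by
    change qgen T ≫ (ClosedSubvariety.ofPoint Y.left Q.pt).ι ≫ prXX.left = _
    exact ((congrArg (· ≫ ((ClosedSubvariety.ofPoint Y.left Q.pt).ι ≫ prXX.left)) hqgen.symm).trans
      ((Category.assoc _ _ _).trans (congrArg (Spec.map (CommRingCat.ofHom φ) ≫ ·) hτι)))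
  have haTi : aT ≫ i.left = Spec.map (CommRingCat.ofHom φa.toRingHom) ≫ (pointOfVec k (v₁ 0) hp0).left := by
    rw [haT, Category.assoc]
    exact congrArg (Spec.map (CommRingCat.ofHom φ) ≫ ·) (congrArg CommaMorphism.left hp)
  have hptp : (pointOfVec T.left.functionField (V₁ 0) (hV₁.ne_zero 0)).pt = uPt (d + 1) T X i aT haT_ha :=
    link aT haT_ha (v₁ 0) hp0 haTi
  have hu₁0 : uX₁ 0 = uXPt T X aT haT_ha := hinjK (by rw [huX₁ 0, iK_uXPt]; exact hptp)
  haveI : @IsPreimmersion (Spec (CommRingCat.of K₀)) X.left a₀.left := ‹IsPreimmersion a₀.left›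
  haveI hpreaT : IsPreimmersion aT := by rw [haT]; exact IsPreimmersion.comp _ _
  have haTpt : aT.base (IsLocalRing.closedPoint _) = z := by
    rw [haT, ← ha₀z]
    change a₀.left.base ((Spec.map (CommRingCat.ofHom φ)).base (IsLocalRing.closedPoint _)) =
      a₀.left.base (IsLocalRing.closedPoint K₀)
    congr 1
    exact Subsingleton.elim (α := PrimeSpectrum K₀) _ _
  -- (i) the `γ`-section pushes forward to `[S]`
  have hMa : AlgebraicCycle.map (CartesianMonoidalCategory.fst X T).left height height
      (primeCycle ((ιX T X).base (uXPt T X aT haT_ha))) = primeCycle z := by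
    have hliftpt : (ιX T X).base (uXPt T X aT haT_ha) =
        (liftPt T X aT haT_ha).base (IsLocalRing.closedPoint _) := by
      change ((tPt T X aT haT_ha ≫ ιX T X).base _) = _
      rw [tPt_ιX]
    rw [hliftpt]
    haveI : LocallyOfFiniteType ((CartesianMonoidalCategory.fst X T).left ≫ X.hom) :=
      inferInstanceAs (LocallyOfFiniteType (X ⊗ T).hom)
    rw [algebraicCycleMap_primeCycle_of_residueFieldMap_surjective
      (CartesianMonoidalCategory.fst X T).left X.hom ((liftPt T X aT haT_ha).base _) ?_]
    · rw [← haTpt]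
      congr 1
      change ((liftPt T X aT haT_ha ≫ (CartesianMonoidalCategory.fst X T).left).base _) = _
      rw [liftPt_fst]
    · refine residueFieldMap_surjective_of_comp (liftPt T X aT haT_ha) _ _ ?_
      have key : ∀ g : Spec T.left.functionField ⟶ X.left, g = aT →
          Function.Surjective (g.residueFieldMap (IsLocalRing.closedPoint _)) := by
        rintro g rfl; exact residueFieldMap_surjective_of_isPreimmersion _ _
      exact key _ (liftPt_fst T X aT haT_ha)
  -- the constant point `x₀ ⊗ K`
  haveI : LocallyOfFiniteType X.hom := by rw [← Over.w i]; infer_instance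
  let aT' : Spec T.left.functionField ⟶ X.left := qgen T ≫ T.hom ≫ pointOfClosedPoint X.hom x₀ hx₀
  have haT'_ha : aT' ≫ X.hom = qgen T ≫ T.hom := by
    simp only [aT', Category.assoc, pointOfClosedPoint_comp, Category.comp_id]
  have haT'pt : aT'.base (IsLocalRing.closedPoint _) = x₀ := pointOfClosedPoint_apply X.hom x₀ hx₀ _
  have hqT : qgen T ≫ T.hom = Spec.map (CommRingCat.ofHom φ) ≫ Spec.map (CommRingCat.ofHom (algebraMap k K₀)) := by
    rw [qgen_comp_hom, halgT, ← Spec.map_comp]; rfl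
  have haT'i : aT' ≫ i.left = Spec.map (CommRingCat.ofHom φa.toRingHom) ≫ (pointOfVec k (v₂ 0) hq0).left := by
    rw [← hq]
    change (qgen T ≫ T.hom ≫ pointOfClosedPoint X.hom x₀ hx₀) ≫ i.left =
      Spec.map (CommRingCat.ofHom φ) ≫ (Spec.map (CommRingCat.ofHom (algebraMap k K₀)) ≫
        pointOfClosedPoint X.hom x₀ hx₀) ≫ i.left
    rw [← Category.assoc (qgen T), hqT]
    simp only [Category.assoc]
  have hptq : (pointOfVec T.left.functionField (V₂ 0) (hV₂.ne_zero 0)).pt = uPt (d + 1) T X i aT' haT'_ha :=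
    link aT' haT'_ha (v₂ 0) hq0 haT'i
  have hu₂0 : uX₂ 0 = uXPt T X aT' haT'_ha := hinjK (by rw [huX₂ 0, iK_uXPt]; exact hptq)
  -- (ii) the constant section pushes forward to `0`
  have hMa₀ : AlgebraicCycle.map (CartesianMonoidalCategory.fst X T).left height height
      (primeCycle ((ιX T X).base (uXPt T X aT' haT'_ha))) = 0 := by
    rw [algebraicCycleMap_primeCycle_eq_nsmul]
    have h2 : height ((ιX T X).base (uXPt T X aT' haT'_ha)) = 2 := by
      let V : ClosedSubvariety (XK T X) := ClosedSubvariety.ofPoint _ (uXPt T X aT' haT'_ha)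
      have hdV := dim_image_eq hPB hi hT2 V
      have hV : V.dim = 0 := by
        change height V.genericPoint = 0
        rw [ClosedSubvariety.genericPoint_ofPoint, ← height_base_eq_of_isClosedImmersion' (iK (d + 1) T X i),
          iK_uXPt, height_uPt]
      have hI : (V.image (ιX T X)).dim = height ((ιX T X).base (uXPt T X aT' haT'_ha)) := by
        change height (V.image (ιX T X)).genericPoint = _
        rw [ClosedSubvariety.genericPoint_image, ClosedSubvariety.genericPoint_ofPoint]
      rw [← hI, hdV, hV]
      rfl
    have h0 : height ((CartesianMonoidalCategory.fst X T).left.base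
        ((ιX T X).base (uXPt T X aT' haT'_ha))) = 0 := by
      rw [fst_ιX_uXPt, haT'pt, hx₀0]
    have hne : height ((ιX T X).base (uXPt T X aT' haT'_ha)) ≠
        height ((CartesianMonoidalCategory.fst X T).left.base ((ιX T X).base (uXPt T X aT' haT'_ha))) := by
      rw [h2, h0]; exact two_ne_zero
    rw [AlgebraicCycle.mapCoeff, if_neg hne, zero_smul]
  -- conversion of a plane-supported cycle into a finite sum
  have finish : ∀ Pl : AlgebraicCycle X.left ℤ, (∀ y, Pl y ≠ 0 → IsLinearSubspacePoint 2 (d + 1) i y) →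
      primeCycle z - Pl ∈ ratTrivial X.left 2 →
      ∃ (s : Finset ↥X.left) (w : ↥X.left → ℤ), (∀ y ∈ s, IsLinearSubspacePoint 2 (d + 1) i y) ∧
        IsRationallyEquivalent (primeCycle z) (∑ y ∈ s, w y • primeCycle y) 2 := by
    intro Pl hPl hrat
    refine ⟨(finite_support_of_compactSpace Pl).toFinset, fun y => Pl y, fun y hy => hPl y
      (Function.mem_support.mp ((Set.Finite.mem_toFinset _).mp hy)), ?_⟩
    change _ - ∑ y ∈ (finite_support_of_compactSpace Pl).toFinset, Pl y • primeCycle y ∈ ratTrivial X.left 2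
    rw [← eq_sum_smul_primeCycle_of_support_subset Pl (s := (finite_support_of_compactSpace Pl).toFinset)
      (by rw [Set.Finite.coe_toFinset])]
    exact hrat
  have hplane_sub : ∀ (A B : AlgebraicCycle X.left ℤ),
      (∀ y, A y ≠ 0 → IsLinearSubspacePoint 2 (d + 1) i y) →
      (∀ y, B y ≠ 0 → IsLinearSubspacePoint 2 (d + 1) i y) →
      ∀ y, (A - B) y ≠ 0 → IsLinearSubspacePoint 2 (d + 1) i y := by
    intro A B hA hB y hy
    by_cases h : A y = 0
    · have : B y ≠ 0 := by
        intro h'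
        apply hy
        rw [Function.locallyFinsuppWithin.coe_sub, Pi.sub_apply, h, h', sub_zero]
      exact hB y this
    · exact hA y h
  have hMrat : ∀ c' ∈ ratTrivial (X ⊗ T).left 2,
      AlgebraicCycle.map (CartesianMonoidalCategory.fst X T).left height height c' ∈ ratTrivial X.left 2 :=
    fun c' hc' => map_mem_ratTrivial_holds (d := 2) (CartesianMonoidalCategory.fst X T) hc'
  rw [hu₁0, hMa] at hX₁
  rw [hu₂0, hMa₀] at hX₂
  rcases hsecond with hrq | hrr
  · -- one line `p q`: the second point of the first family is the constant point
    have hu₁1 : uX₁ 1 = uXPt T X aT' haT'_ha := hinjK (by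
      rw [huX₁ 1, iK_uXPt, ← hptq]
      congr 1
      have : V₁ 1 = V₂ 0 := by change ⇑φa ∘ v₁ 1 = ⇑φa ∘ v₂ 0; rw [hrq]
      simp only [this])
    rw [hu₁1, hMa₀, sub_zero] at hX₁
    refine finish (-Pl₁) (fun y hy => hPl₁ y (by
      rwa [Function.locallyFinsuppWithin.coe_neg, Pi.neg_apply, neg_ne_zero] at hy)) ?_
    have h := sub_mem (hMrat c₁ hc₁) hX₁
    convert h using 1
    abel
  · -- two lines through the common point `r`: the `r`-sections cancel
    have hu₁1 : uX₁ 1 = uX₂ 1 := hinjK (by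
      rw [huX₁ 1, huX₂ 1]
      congr 1
      have : V₁ 1 = V₂ 1 := by change ⇑φa ∘ v₁ 1 = ⇑φa ∘ v₂ 1; rw [hrr]
      simp only [this])
    rw [hu₁1] at hX₁
    refine finish (Pl₂ - Pl₁) (hplane_sub Pl₂ Pl₁ hPl₂ hPl₁) ?_
    have h := sub_mem (sub_mem (hMrat c₁ hc₁) (hMrat c₂ hc₂)) (sub_mem hX₁ hX₂)
    convert h using 1
    abel

end TwoLines

/-! ### The main statement -/

section Main

variable [IsAlgClosed k] {d : ℕ} (X : SchemeOver k) (i : X ⟶ projectiveSpace (d + 1) k)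
  [IsClosedImmersion i.left] {F : MvPolynomial (Fin (d + 1 + 1)) k}

/-- **Every integral surface of a cubic hypersurface of dimension `d ≥ 18` is rationally equivalent
to an integral combination of planes** — input (a) of Mboro's Cor. 2.9 (i) for `d ≥ 18`, by the
product trick (module docstring). [cite: TianZong2014, Prop. 7.2 (proof)] [cite: Mboro2018, Cor. 2.9]
[cite: Pfister1995, Ch. 5 Cor. 1.5] -/
theorem exists_planes_of_height_two (hd : 18 ≤ d) (hF3 : F.IsHomogeneous 3)
    (hrange : Set.range i.left.base =
      ProjectiveSpectrum.zeroLocus (homogeneousSubmodule (Fin (d + 1 + 1)) k) {F})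
    (z : ↥X.left) (hz : height z = 2) :
    ∃ (s : Finset ↥X.left) (w : ↥X.left → ℤ), (∀ y ∈ s, IsLinearSubspacePoint 2 (d + 1) i y) ∧
      IsRationallyEquivalent (primeCycle z) (∑ y ∈ s, w y • primeCycle y) 2 := by
  classical
  haveI : IsProper (projectiveSpace (d + 1) k).hom := isProper_projectiveSpace (d + 1) k
  haveI : IsProper X.hom := by rw [← Over.w i]; infer_instance
  haveI : LocallyOfFiniteType X.hom := by rw [← Over.w i]; infer_instance
  -- the generic point of `S = closure {z}` as a `K₀`-point, `K₀ = κ(z)`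
  letI algK : Algebra k (X.left.residueField z) :=
    ((Scheme.ΓSpecIso (CommRingCat.of k)).inv ≫ X.hom.appTop ≫ X.left.Γevaluation z).hom.toAlgebra
  have halg : Spec.map (CommRingCat.ofHom (algebraMap k (X.left.residueField z))) =
      X.left.fromSpecResidueField z ≫ X.hom :=
    Scheme.SpecMap_ΓSpecIso_inv_appTop_Γevaluation X.hom z
  let a₀ : AlgPoints X (X.left.residueField z) := AlgPoints.mk (X.left.fromSpecResidueField z) halg.symm
  haveI : IsPreimmersion a₀.left := inferInstanceAs (IsPreimmersion (X.left.fromSpecResidueField z))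
  have ha₀z : a₀.pt = z := Scheme.fromSpecResidueField_apply z _
  -- `trdeg_k κ(z) = 2`, so `κ(z)` is `C₂` for systems
  have htr : Algebra.trdeg k (X.left.residueField z) = 2 := by
    have h := Scheme.height_eq_toENat_trdeg_residueField X.hom z halg
    rw [hz] at h
    exact_mod_cast (Cardinal.toENat_eq_ofNat.mp h.symm)
  have hK : IsCrSystem 2 (X.left.residueField z) := isCrSystem_two_of_trdeg_eq_two htr
  -- a closed point `x₀` of `X` (the first element of a maximal chain ending at `z`)
  obtain ⟨x₀, hx₀0⟩ : ∃ x₀ : ↥X.left, height x₀ = 0 := by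
    obtain ⟨c, hclast, hclen⟩ := Order.exists_series_of_height_eq_coe z hz
    refine ⟨c 0, ?_⟩
    have h := Order.height_eq_index_of_length_eq_height_last (p := c) (by rw [hclast, hz, hclen]; rfl) 0
    simpa using h
  have hx₀cl : IsClosed ({x₀} : Set ↥X.left) := isClosed_singleton_of_height_eq_zero' hx₀0
  -- the constant `K₀`-point at `x₀` and the homogeneous coordinates of the two points
  let a₀' : AlgPoints X (X.left.residueField z) :=
    AlgPoints.mk (Spec.map (CommRingCat.ofHom (algebraMap k (X.left.residueField z))) ≫
      pointOfClosedPoint X.hom x₀ hx₀cl) (by rw [Category.assoc, pointOfClosedPoint_comp, Category.comp_id])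
  have ha₀'pt : a₀'.pt = x₀ := by
    change (Spec.map (CommRingCat.ofHom (algebraMap k (X.left.residueField z))) ≫
      pointOfClosedPoint X.hom x₀ hx₀cl).base (IsLocalRing.closedPoint _) = x₀
    exact pointOfClosedPoint_apply X.hom x₀ hx₀cl _
  obtain ⟨p₀, hp₀0, hPp⟩ := exists_eq_pointOfVec (AlgPoints.map i a₀)
  obtain ⟨q₀, hq₀0, hPq⟩ := exists_eq_pointOfVec (AlgPoints.map i a₀')
  -- `F` vanishes at `p₀` and `q₀`
  have hFpt : ∀ (Q' : AlgPoints X (X.left.residueField z)) (u : Fin (d + 1 + 1) → X.left.residueField z)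
      (hu : u ≠ 0), AlgPoints.map i Q' = pointOfVec k u hu →
      eval u (MvPolynomial.map (algebraMap k (X.left.residueField z)) F) = 0 := by
    intro Q' u hu h
    have hmem : (pointOfVec k u hu).pt ∈ Set.range i.left.base := by
      rw [← h]; exact ⟨Q'.pt, rfl⟩
    rw [hrange] at hmem
    have h3 := (pt_pointOfVec_mem_zeroLocus_iff u hu (by norm_num : 0 < 3)
      ((mem_homogeneousSubmodule 3 F).mpr hF3)).1 hmem
    rw [MvPolynomial.eval_map]
    exact h3
  have hFp := hFpt a₀ p₀ hp₀0 hPp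
  have hFq := hFpt a₀' q₀ hq₀0 hPq
  -- `p₀, q₀` are independent (`z ≠ x₀`)
  have hpq : LinearIndependent (X.left.residueField z) ![p₀, q₀] := by
    by_contra hdep
    obtain ⟨c₀, hc₀, hqc⟩ := exists_eq_smul_of_not_linearIndependent hp₀0 hq₀0 hdep
    have heq : pointOfVec k p₀ hp₀0 = pointOfVec k q₀ hq₀0 :=
      (pointOfVec_eq_pointOfVec_iff p₀ q₀ hp₀0 hq₀0).mpr ⟨c₀, hc₀, hqc⟩
    have hmap : AlgPoints.map i a₀ = AlgPoints.map i a₀' := by rw [hPp, hPq, heq]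
    have hpts : a₀.pt = a₀'.pt := congrArg AlgPoints.pt (AlgPoints.map_injective_of_mono i hmap)
    rw [ha₀z, ha₀'pt] at hpts
    rw [hpts, hx₀0] at hz
    exact absurd hz (by norm_num)
  -- Tsen–Lang: a common point `r₀` of the two cubic cones
  obtain ⟨r₀, hr₀0, hr⟩ := exists_two_line_chain_of_isCrSystem hK
    (F := fun _ : Fin 1 => MvPolynomial.map (algebraMap k (X.left.residueField z)) F) (d := fun _ => 3)
    (fun _ => hF3.map _) (fun _ => by norm_num)
    (by rw [two_point_chain_count_cubic_two]; omega) (fun _ => hFp) (fun _ => hFq)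
  have hswap : ∀ (x y : Fin (d + 1 + 1) → X.left.residueField z), LinearIndependent (X.left.residueField z) ![x, y] →
      LinearIndependent (X.left.residueField z) ![y, x] := by
    intro x y h
    have h' := h.comp (Equiv.swap (0 : Fin 2) 1) (Equiv.injective _)
    have hfun : (![x, y] ∘ ⇑(Equiv.swap (0 : Fin 2) 1) : Fin 2 → _) = ![y, x] := by
      ext a j; fin_cases a <;> rfl
    rwa [hfun] at h'
  -- the single line `p₀ q₀`
  have single : (∀ s t : X.left.residueField z,
      eval (s • p₀ + t • q₀) (MvPolynomial.map (algebraMap k (X.left.residueField z)) F) = 0) →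
      ∃ (s : Finset ↥X.left) (w : ↥X.left → ℤ), (∀ y ∈ s, IsLinearSubspacePoint 2 (d + 1) i y) ∧
        IsRationallyEquivalent (primeCycle z) (∑ y ∈ s, w y • primeCycle y) 2 := fun hFpq =>
    exists_planes_of_two_lines X i (by omega) hF3 hrange htr a₀ ha₀z hx₀cl hx₀0 ![p₀, q₀] ![q₀, p₀]
      hpq (hswap _ _ hpq) hFpq (fun s t => by
        change eval (s • q₀ + t • p₀) _ = 0
        rw [add_comm (s • q₀)]; exact hFpq t s) hp₀0 hPp hq₀0 hPq (Or.inl rfl)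
  by_cases hpr : LinearIndependent (X.left.residueField z) ![p₀, r₀]
  · by_cases hqr : LinearIndependent (X.left.residueField z) ![q₀, r₀]
    · -- two lines `p₀ r₀`, `q₀ r₀`
      exact exists_planes_of_two_lines X i (by omega) hF3 hrange htr a₀ ha₀z hx₀cl hx₀0 ![p₀, r₀] ![q₀, r₀]
        hpr hqr (fun s t => (hr 0 s t).1) (fun s t => (hr 0 s t).2) hp₀0 hPp hq₀0 hPq (Or.inr rfl)
    · -- `r₀` is a multiple of `q₀`
      obtain ⟨c₀, hc₀, hrq⟩ := exists_eq_smul_of_not_linearIndependent hq₀0 hr₀0 hqr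
      refine single fun s t => ?_
      have h := (hr 0 s (t / c₀)).1
      rwa [hrq, smul_smul, div_mul_cancel₀ t hc₀] at h
  · -- `r₀` is a multiple of `p₀`
    obtain ⟨c₀, hc₀, hrp⟩ := exists_eq_smul_of_not_linearIndependent hp₀0 hr₀0 hpr
    refine single fun s t => ?_
    have h := (hr 0 t (s / c₀)).2
    rwa [hrp, smul_smul, div_mul_cancel₀ s hc₀, add_comm (t • q₀)] at h

end Main

end ProjFamily

/-! ### Mboro's Cor. 2.9 (both clauses) for `dim X ≥ 18` -/

/-- **`CH₂` of a smooth cubic hypersurface of dimension `n ≥ 18` is generated by planes and is `ℤ`**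
— the conclusion of `Mboro2018_chowTwo_cubic` (`Motives/LinearSubspacesGenerateChow`, Mboro
Cor. 2.9 = Cor. 6: bounds `7` and `9`) in the range `n ≥ 18`, as a THEOREM: generation by planes from
`ProjFamily.exists_planes_of_height_two` (the product trick, `19 < n + 2`), and `CH₂(X) ≅ ℤ` from it by
`Hypersurface.nonempty_addEquiv_int_of_chowGeneratedByPlanes` (`Motives/CubicHypersurfacePlanesRatEquiv`,
any two planes are rationally equivalent for `n ≥ 15`, and plane classes are non-torsion).
[cite: Mboro2018, Cor. 2.9] [cite: TianZong2014, Prop. 7.2] -/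
theorem Hypersurface.chowTwo_cubic_of_eighteen_le {k : Type u} [Field k] [IsAlgClosed k] [CharZero k]
    (n : ℕ) {X : SchemeOver k} (F : MvPolynomial (Fin (n + 1 + 1)) k) (i : X ⟶ projectiveSpace (n + 1) k)
    (hX : IsSmoothProjective n X) (hF : F.IsHomogeneous 3) (hirr : Irreducible F)
    [hi : IsClosedImmersion i.left]
    (hV : Set.range i.left.base =
      ProjectiveSpectrum.zeroLocus (MvPolynomial.homogeneousSubmodule (Fin (n + 1 + 1)) k) {F})
    (hn : 18 ≤ n) :
    ChowGeneratedByLinearSubspaces 2 (n + 1) i ∧ Nonempty (ChowGroup X.left 2 ≃+ ℤ) := by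
  haveI : CompactSpace ↥X.left := IsSmoothProjective.compactSpace_holds hX
  have hgen : ChowGeneratedByLinearSubspaces 2 (n + 1) i :=
    ChowGeneratedByLinearSubspaces.of_primeCycle (ProjFamily.exists_planes_of_height_two X i hn hF hV)
  exact ⟨hgen, Hypersurface.nonempty_addEquiv_int_of_chowGeneratedByPlanes n F i hX hF hirr hV (by omega) hgen⟩

/-- The statement of `Mboro2018_chowTwo_cubic` with its two clauses, under the extra hypothesis
`18 ≤ n` (in which range both `7 ≤ n` and `9 ≤ n` hold): proved. [cite: Mboro2018, Cor. 2.9] -/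
theorem Mboro2018_chowTwo_cubic_of_eighteen_le :
    ∀ ⦃k : Type u⦄ [Field k] [IsAlgClosed k] [CharZero k] (n : ℕ) ⦃X : SchemeOver k⦄
      (F : MvPolynomial (Fin (n + 1 + 1)) k) (i : X ⟶ projectiveSpace (n + 1) k),
      IsSmoothProjective n X → F.IsHomogeneous 3 → Irreducible F → IsClosedImmersion i.left →
        Set.range i.left.base =
          ProjectiveSpectrum.zeroLocus (MvPolynomial.homogeneousSubmodule (Fin (n + 1 + 1)) k) {F} →
        18 ≤ n →
          (7 ≤ n → ChowGeneratedByLinearSubspaces 2 (n + 1) i) ∧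
            (9 ≤ n → Nonempty (ChowGroup X.left 2 ≃+ ℤ)) := by
  intro k _ _ _ n X F i hX hF hirr hi hV hn
  obtain ⟨h1, h2⟩ := Hypersurface.chowTwo_cubic_of_eighteen_le n F i hX hF hirr hV hn
  exact ⟨fun _ => h1, fun _ => h2⟩


end Literature.AlgebraicGeometry.Motives

end
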